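import Summits.Ventures.PercRepro.PuncturedLYMSuper

/-!
# PercRepro — (SP) BY SUPERPOSITION, PART 4: THE PACKING COUNT OF THE PROFILE OF A `j`-SET IN A CODE (p10, gen 31)

The radial coupling of a word `B` is below uniform by `e(a)/(n−j)`, `e(a) = (j − a)·dFlux a`, at the outside completions
of a set at distance `a = #(X ∩ B)` from `B`.  The total deficit of the superposition at a `j`-set `X ∉ D` is therefore
`N(X) = Σ_{B ∈ D} e(a_B(X))`; this file counts the words at each distance:
* `card_midSets` — there are `C(j,a)·C(n−j, j−1−a)` sets of size `j − 1` meeting a `j`-set `X` in `a` points;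
* `card_profile_mul_le` — THE PACKING COUNT: `#{B ∈ D : #(X ∩ B) = a}·(j − a) ≤ C(j,a)·C(n−j, j−1−a)` — the map
  `(B, p) ↦ B ∖ p` (`p ∈ B ∖ X`) is injective into the `(j−1)`-sets meeting `X` in `a` points, because a `(j−1)`-set lies
  in at most one code word.
The bound `N(X) ≤ j/(n − j + 1)` is PuncturedLYMProfileSum.  Nothing here asserts (SP).
-/

namespace PercRepro.PuncturedLYM

open Finset

variable {α : Type} [Fintype α] [DecidableEq α]

/-! ### The deficit `e(a)` -/

/-- `e(a) = (j − a)·dFlux a`, the deficit (in units of `1/(n−j)`) of the radial coupling at an outside completion of a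
class-`a` set. -/
def eDef (α : Type) [Fintype α] (j a : ℕ) : ℚ := ((j : ℚ) - a) * dFlux α j a

omit [DecidableEq α] in
/-- `0 ≤ e(a)` for `a ≤ j ≤ n`. -/
theorem eDef_nonneg {j a : ℕ} (ha : a ≤ j) (hj : j ≤ Fintype.card α) : 0 ≤ eDef α j a := by
  unfold eDef
  apply mul_nonneg _ (dFlux_nonneg hj)
  have : (a : ℚ) ≤ j := by exact_mod_cast ha
  linarith

/-! ### The packing count -/

/-- The `(j−1)`-subsets of the ground set meeting `X` in exactly `a` points. -/
def midSets (α : Type) [Fintype α] [DecidableEq α] (j : ℕ) (X : Finset α) (a : ℕ) : Finset (Finset α) :=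
  ((univ : Finset α).powersetCard (j - 1)).filter (fun S => (S ∩ X).card = a)

/-- `#midSets = C(j, a)·C(n − j, j − 1 − a)` for a `j`-set `X` and `a ≤ j − 1` (`1 ≤ j`): a mid-set is the disjoint union
of an `a`-subset of `X` and a `(j−1−a)`-subset of its complement. -/
theorem card_midSets {j : ℕ} {X : Finset α} (hX : X.card = j) {a : ℕ} (ha : a + 1 ≤ j) :
    (midSets α j X a).card = j.choose a * (Fintype.card α - j).choose (j - 1 - a) := by
  -- the product of the two powersets maps bijectively onto the mid-sets by `(A, C) ↦ A ∪ C`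
  have hinj : Set.InjOn (fun p : Finset α × Finset α => p.1 ∪ p.2)
      (((X.powersetCard a) ×ˢ ((univ \ X).powersetCard (j - 1 - a)) : Finset (Finset α × Finset α)) :
        Set (Finset α × Finset α)) := by
    rintro ⟨A, C⟩ hp ⟨A', C'⟩ hp' h
    simp only [mem_coe, mem_product, mem_powersetCard] at hp hp'
    have hAX : A ⊆ X := hp.1.1
    have hCX : C ⊆ univ \ X := hp.2.1
    have hA'X : A' ⊆ X := hp'.1.1
    have hC'X : C' ⊆ univ \ X := hp'.2.1
    have h' : A ∪ C = A' ∪ C' := h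
    have e1 : (A ∪ C) ∩ X = A := by
      ext w
      simp only [mem_inter, mem_union]
      constructor
      · rintro ⟨hw | hw, hwX⟩
        · exact hw
        · exact absurd hwX (mem_sdiff.1 (hCX hw)).2
      · intro hw
        exact ⟨Or.inl hw, hAX hw⟩
    have e1' : (A' ∪ C') ∩ X = A' := by
      ext w
      simp only [mem_inter, mem_union]
      constructor
      · rintro ⟨hw | hw, hwX⟩
        · exact hw
        · exact absurd hwX (mem_sdiff.1 (hC'X hw)).2
      · intro hw
        exact ⟨Or.inl hw, hA'X hw⟩
    have e2 : (A ∪ C) \ X = C := by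
      ext w
      simp only [mem_sdiff, mem_union]
      constructor
      · rintro ⟨hw | hw, hwX⟩
        · exact absurd (hAX hw) hwX
        · exact hw
      · intro hw
        exact ⟨Or.inr hw, (mem_sdiff.1 (hCX hw)).2⟩
    have e2' : (A' ∪ C') \ X = C' := by
      ext w
      simp only [mem_sdiff, mem_union]
      constructor
      · rintro ⟨hw | hw, hwX⟩
        · exact absurd (hA'X hw) hwX
        · exact hw
      · intro hw
        exact ⟨Or.inr hw, (mem_sdiff.1 (hC'X hw)).2⟩
    have hA : A = A' := by rw [← e1, ← e1', h']
    have hC : C = C' := by rw [← e2, ← e2', h']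
    rw [hA, hC]
  have himg : ((X.powersetCard a) ×ˢ ((univ \ X).powersetCard (j - 1 - a))).image
      (fun p : Finset α × Finset α => p.1 ∪ p.2) = midSets α j X a := by
    ext S
    simp only [mem_image, mem_product, mem_powersetCard, midSets, mem_filter, subset_univ, true_and]
    constructor
    · rintro ⟨⟨A, C⟩, ⟨⟨hAX, hAc⟩, ⟨hCX, hCc⟩⟩, rfl⟩
      have hdisj : Disjoint A C := by
        rw [disjoint_left]
        intro w hwA hwC
        exact (mem_sdiff.1 (hCX hwC)).2 (hAX hwA)
      refine ⟨?_, ?_⟩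
      · rw [card_union_of_disjoint hdisj, hAc, hCc]
        omega
      · have : (A ∪ C) ∩ X = A := by
          ext w
          simp only [mem_inter, mem_union]
          constructor
          · rintro ⟨hw | hw, hwX⟩
            · exact hw
            · exact absurd hwX (mem_sdiff.1 (hCX hw)).2
          · intro hw
            exact ⟨Or.inl hw, hAX hw⟩
        rw [this, hAc]
    · rintro ⟨hSc, hSa⟩
      refine ⟨⟨S ∩ X, S \ X⟩, ⟨⟨inter_subset_right, hSa⟩, ⟨?_, ?_⟩⟩, ?_⟩
      · intro w hw
        rw [mem_sdiff] at hw ⊢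
        exact ⟨mem_univ w, hw.2⟩
      · show (S \ X).card = j - 1 - a
        have := card_sdiff_add_card_inter S X
        omega
      · show S ∩ X ∪ S \ X = S
        ext w
        simp only [mem_union, mem_inter, mem_sdiff]
        tauto
  rw [← himg, card_image_of_injOn hinj, card_product, card_powersetCard, card_powersetCard, hX, card_univ_sdiff, hX]

/-- **The packing count**: `#{B ∈ D : #(X ∩ B) = a}·(j − a) ≤ #midSets` — each word at distance `a` from `X` has `j − a`
points outside `X`, and `(B, p) ↦ B ∖ p` is injective into the mid-sets (a `(j−1)`-set lies in at most one code word). -/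
theorem card_profile_mul_le {j : ℕ} {D : Finset (Finset α)} (hD : IsCode j D) {X : Finset α} (hX : X.card = j)
    {a : ℕ} (ha : a < j) :
    (D.filter (fun B => (X ∩ B).card = a)).card * (j - a) ≤ (midSets α j X a).card := by
  set F := D.filter (fun B => (X ∩ B).card = a) with hF
  -- the pairs `(B, p)`, `B ∈ F`, `p ∈ B ∖ X`
  have hcard : (F.sigma (fun B => B \ X)).card = F.card * (j - a) := by
    rw [card_sigma]
    have : ∀ B ∈ F, (B \ X).card = j - a := by
      intro B hB
      rw [hF, mem_filter] at hB
      have h1 := card_sdiff_add_card_inter B X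
      rw [inter_comm, hB.2, hD.1 B hB.1] at h1
      omega
    rw [sum_congr rfl this, sum_const, smul_eq_mul]
  have hinj : Set.InjOn (fun p : Σ _ : Finset α, α => p.1.erase p.2) (F.sigma (fun B => B \ X) : Set _) := by
    rintro ⟨B, p⟩ hp ⟨B', p'⟩ hp' h
    simp only [coe_sigma, Set.mem_sigma_iff, mem_coe] at hp hp'
    rw [hF, mem_filter] at hp hp'
    have h' : B.erase p = B'.erase p' := h
    have hpB : p ∈ B := (mem_sdiff.1 hp.2).1
    have hp'B : p' ∈ B' := (mem_sdiff.1 hp'.2).1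
    have hBB' : B = B' := by
      by_contra hne
      have h1 := hD.2 B hp.1.1 B' hp'.1.1 hne
      have h2 : B.erase p ⊆ B ∩ B' := by
        intro w hw
        rw [mem_inter]
        refine ⟨mem_of_mem_erase hw, ?_⟩
        rw [h'] at hw
        exact mem_of_mem_erase hw
      have := card_le_card h2
      rw [card_erase_of_mem hpB, hD.1 B hp.1.1] at this
      omega
    subst hBB'
    have hpp' : p = p' := erase_injOn B hpB hp'B h'
    rw [hpp']
  have hsub : (F.sigma (fun B => B \ X)).image (fun p : Σ _ : Finset α, α => p.1.erase p.2) ⊆ midSets α j X a := by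
    intro S hS
    rw [mem_image] at hS
    obtain ⟨⟨B, p⟩, hp, rfl⟩ := hS
    simp only [mem_sigma] at hp
    rw [hF, mem_filter] at hp
    have hpB : p ∈ B := (mem_sdiff.1 hp.2).1
    have hpX : p ∉ X := (mem_sdiff.1 hp.2).2
    rw [midSets, mem_filter, mem_powersetCard]
    refine ⟨⟨subset_univ _, ?_⟩, ?_⟩
    · rw [card_erase_of_mem hpB, hD.1 B hp.1.1]
    · have : B.erase p ∩ X = X ∩ B := by
        ext w
        simp only [mem_inter, mem_erase]
        constructor
        · rintro ⟨⟨-, hwB⟩, hwX⟩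
          exact ⟨hwX, hwB⟩
        · rintro ⟨hwX, hwB⟩
          exact ⟨⟨fun h => hpX (h ▸ hwX), hwB⟩, hwX⟩
      rw [this, hp.1.2]
  calc F.card * (j - a) = (F.sigma (fun B => B \ X)).card := hcard.symm
    _ = ((F.sigma (fun B => B \ X)).image (fun p : Σ _ : Finset α, α => p.1.erase p.2)).card :=
        (card_image_of_injOn hinj).symm
    _ ≤ (midSets α j X a).card := card_le_card hsub

end PercRepro.PuncturedLYM
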